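import Mathlib
import Summits.NavierStokesRegularity.NavierStokesRegularity.Theorems.FilamentSkeletonRssStadiumPlateauBound
import Summits.NavierStokesRegularity.NavierStokesRegularity.Theorems.FilamentSkeletonRssStadiumConstants

/-!
# Plateau bound in the concrete retype geometry (`TangentSkeletonNearStraightL`, stmt-NavierStokesRegularity-23320, registered stub
# `stub_stripPropagation` — blueprint item R6′, plateau, instantiated)

`16h ≤ hs`, `S₁₆ = {|Im| < h, |Re − c| < L + h}`, plateau `[c − P, c + P]` at the target's own height, `P = L + 8h`, Cauchy radius `R₀ = 7h`, ratio 8,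
`M = 2`, `0 ≤ Rb ≤ 1/2`, `A₁ = 1 − (Rb + 2E)²/2 ≥ 4/5` (Theorems.StadiumConstants).  For every `z ∈ S₁₆`, provided `μ/√A₁ ≤ 2P` (`μ = √(κ/(2Λ))`; true for
`Γ ≥ Γ₀`):  `‖∫_{c−P}^{c+P} K(z, σ + i·Im z) dσ‖ ≤ 4·2·(2/(7h))·(1/3 + log(2P·√A₁/μ))/A₁^{3/2}` (`plateau_norm_le_concrete`) — `O(log Γ/√Γ)` per unit
circulation, the `√Γ log Γ` of the stub after the prefactor `Γγ/4π`.  HONEST FRAMING: bookkeeping for a HYPOTHETICAL filament skeleton on the NEGATIVE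
side of a MODEL route; nothing here bears on Navier–Stokes regularity or blow-up.  `--supports stmt-NavierStokesRegularity-23320`.
-/

set_option linter.dupNamespace false

noncomputable section

namespace Summit.NavierStokesRegularity.NavierStokesRegularity.Theorems.StadiumPlateauConcrete

open Set Metric MeasureTheory Complex
open scoped InnerProductSpace Matrix
open Summit.NavierStokesRegularity.NavierStokesRegularity.Theorems.StadiumPlateauBound
open Summit.NavierStokesRegularity.NavierStokesRegularity.Theorems.StadiumConstants

/-- **Concrete plateau bound.**  See the module docstring. [folklore] -/
theorem plateau_norm_le_concrete {hs L cc Rb h κ Λ : ℝ} {F : ℂ → (Fin 3 → ℂ)} {G : ℂ → ℂ}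
    (hF : DifferentiableOn ℂ F {z : ℂ | |z.im| < hs ∧ |z.re - cc| < L + hs})
    (hunit : ∀ w ∈ {z : ℂ | |z.im| < hs ∧ |z.re - cc| < L + hs}, ∑ i, (deriv F w i) ^ 2 = 1)
    (hM : ∀ z ∈ {z : ℂ | |z.im| < hs ∧ |z.re - cc| < L + hs}, ‖deriv F z‖ ≤ 2)
    {X : ℝ → EuclideanSpace ℝ (Fin 3)} (hX : Differentiable ℝ X) (hXu : ∀ τ, ‖deriv X τ‖ = 1)
    (hRb0 : 0 ≤ Rb) (hRb : Rb ≤ 1 / 2) (hosc : ∀ τ σ, ‖deriv X τ - deriv X σ‖ ≤ Rb)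
    (hFX : ∀ r : ℝ, (r : ℂ) ∈ {z : ℂ | |z.im| < hs ∧ |z.re - cc| < L + hs} →
      F r = fun i => ((⟪X r, EuclideanSpace.single i (1:ℝ)⟫_ℝ : ℝ) : ℂ))
    (hGre : ∀ w ∈ {z : ℂ | |z.im| < hs ∧ |z.re - cc| < L + hs}, Λ⁻¹ / 2 ≤ (G w).re)
    (hκ : 0 < κ) (hΛ : 0 < Λ) (hh : 0 < h) (h16 : 16 * h ≤ hs) (hL : 0 ≤ L) {z : ℂ} (hz : |z.im| < h ∧ |z.re - cc| < L + h)
    (hR : √(κ / (2 * Λ)) / √(1 - (Rb + 2 * (√3 * (2 * 2 * (Real.log ((8:ℝ) / (8 - 1)) - 1 / 8)))) ^ 2 / 2) ≤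
      (cc + (L + 8 * h)) - (cc - (L + 8 * h))) :
    ‖∫ σ in (cc - (L + 8 * h))..(cc + (L + 8 * h)), (((∑ i, (F z i - F ((σ : ℂ) + (z.im : ℂ) * I) i) ^ 2) +
          (κ : ℂ) * G ((σ : ℂ) + (z.im : ℂ) * I)) ^ ((3:ℂ) / 2))⁻¹ •
        (deriv F ((σ : ℂ) + (z.im : ℂ) * I) ⨯₃ (fun i => F z i - F ((σ : ℂ) + (z.im : ℂ) * I) i))‖ ≤
      4 * (2 * (2 / (7 * h))) * ((1/3 + Real.log (((cc + (L + 8 * h)) - (cc - (L + 8 * h))) *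
          √(1 - (Rb + 2 * (√3 * (2 * 2 * (Real.log ((8:ℝ) / (8 - 1)) - 1 / 8)))) ^ 2 / 2) / √(κ / (2 * Λ)))) /
        (1 - (Rb + 2 * (√3 * (2 * 2 * (Real.log ((8:ℝ) / (8 - 1)) - 1 / 8)))) ^ 2 / 2) ^ (3/2 : ℝ)) := by
  set P : ℝ := L + 8 * h with hP
  have hPpos : 0 < P := by rw [hP]; linarith
  have hA := ratio8_A_ge hRb0 hRb
  have hc : 0 < 1 - (Rb + 2 * (√3 * (2 * 2 * (Real.log ((8:ℝ) / (8 - 1)) - 1 / 8)))) ^ 2 / 2 := lt_of_lt_of_le (by norm_num) hA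
  have hτ : z.re ∈ Icc (cc - P) (cc + P) := by
    have := hz.2; rw [abs_lt] at this; constructor <;> linarith [this.1, this.2]
  have hfit : 8 * |z.im| < hs := by linarith [hz.1]
  have hfit' : ∀ σ ∈ Icc (cc - P) (cc + P), |σ - cc| + 8 * |z.im| < L + hs := by
    intro σ hσ
    have : |σ - cc| ≤ P := abs_le.2 ⟨by linarith [hσ.1], by linarith [hσ.2]⟩
    linarith [hz.1]
  have hdisc : ∀ σ ∈ Set.uIcc (cc - P) (cc + P), closedBall ((σ : ℂ) + (z.im : ℂ) * Complex.I) (7 * h) ⊆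
      {z : ℂ | |z.im| < hs ∧ |z.re - cc| < L + hs} := by
    intro σ hσ w hw
    rw [uIcc_of_le (by linarith : cc - P ≤ cc + P)] at hσ
    rw [mem_closedBall, dist_eq_norm] at hw
    have hσcc : |σ - cc| ≤ P := abs_le.2 ⟨by linarith [hσ.1], by linarith [hσ.2]⟩
    have him : |w.im - z.im| ≤ 7 * h := by
      have h1 := Complex.abs_im_le_norm (w - ((σ : ℂ) + (z.im : ℂ) * Complex.I))
      have e : (w - ((σ : ℂ) + (z.im : ℂ) * Complex.I)).im = w.im - z.im := by simp
      rw [e] at h1; exact h1.trans hw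
    have hre : |w.re - σ| ≤ 7 * h := by
      have h1 := Complex.abs_re_le_norm (w - ((σ : ℂ) + (z.im : ℂ) * Complex.I))
      have e : (w - ((σ : ℂ) + (z.im : ℂ) * Complex.I)).re = w.re - σ := by simp
      rw [e] at h1; exact h1.trans hw
    refine ⟨?_, ?_⟩
    · have := abs_add_le (w.im - z.im) z.im
      rw [show w.im - z.im + z.im = w.im by ring] at this; linarith [hz.1]
    · have := abs_add_le (w.re - σ) (σ - cc)
      rw [show w.re - σ + (σ - cc) = w.re - cc by ring] at this; linarith
  have h := plateau_norm_le (n := 8) (M := 2) (R₀ := 7 * h) hF hunit hM hX hXu hosc hFX hGre (by norm_num) hκ hΛ (by positivity)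
    (by linarith : cc - P ≤ cc + P) hτ hfit hfit' hdisc hc hR
  have hzeq : ((z.re : ℝ) : ℂ) + ((z.im : ℝ) : ℂ) * Complex.I = z := Complex.re_add_im z
  rw [hzeq] at h
  simpa [hP] using h

end Summit.NavierStokesRegularity.NavierStokesRegularity.Theorems.StadiumPlateauConcrete

end
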